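import Summits.AtomisticToContinuum.BoseEinsteinCondensation.Theorems.BECCutLineWeakDisorderLandscapeBoundSiblingDefs
import Summits.AtomisticToContinuum.BoseEinsteinCondensation.Theorems.BECCutLineWeakDisorderLandscapeBoundSiblingTelescope
import Summits.AtomisticToContinuum.BoseEinsteinCondensation.Theorems.BECCutLineWeakDisorderTwoReplicaTransienceBoundFactorisation
import Literature.MathematicalPhysics.QuantumManyBody.GroundStateFeynmanKacGaussian
import Literature.MathematicalPhysics.QuantumManyBody.GroundStateFeynmanKacSemigroup
import Literature.MathematicalPhysics.QuantumManyBody.SwapPurity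
import Mathlib
import HarnessLib

/-!
# Stub `stub_uvFlatness` (crux stmt-AtomisticToContinuum-9087, line sibling-telescoping-chaining),
# wave 2, route R3: one-step domination + Gaussian smoothing (no PDE regularity)

OUTCOME: `stub-blocked` on the comparison (iii) of route R3, stated below as ONE Lean proposition
`BlockMassComparison` over the tree's vocabulary, with the KERNEL-CHECKED reduction
`uvFlatness_of_blockMassComparison : BlockMassComparison → UVFlatness` (this file, sorry-free,
axioms `{propext, Classical.choice, Quot.sound}`). Steps (A) and (B) of the route are PROVED in
the self-contained section `### R3 deterministic part` (namespace `UVFlatnessR3`, plain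
docstrings, no new `Prop`), ready to be appended to a tree file of the line.

## What is proved (all over `GroundStateFeynmanKac*.lean`, the TwoReplica `Defs`/`Factorisation`
## files and the line's `…SiblingDefs` / `…SiblingTelescope`)

* `heat s x z = ∏_k gaussianPDF (x_k) (2s) (z_k)` — the one-line free heat kernel on `ℝ³`
  (`N = 1` instance of the tree's product kernel); measurability, peak bound `heat_le_peak`,
  Gaussian expectation of one line `lintegral_wienerLine_eq`
  (`E[G(x + √2 b_s)] = ∫ p_s(x,z) G(z) dz`, from `lintegral_worldLine_eq` at `N = 1`).
* `stepMajorant v L s t Y z = F_{s,t}(z, Y) = ∫ fkWeight v L s Y ωb · Z_t(z :: B_s(ωb)) dW_n(ωb)`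
  (bath evolved for time `s` under its own killed interacting weight, tagged particle inserted at
  `z` at time `s` for the remaining time `t`); measurable in `z`, vanishing off `Λ_L`.
* (A) `fkPartition_vecCons_le_gaussian_step`:
  `Z_{s+t}(x :: Y) ≤ ∫ p_s(x, z) F_{s,t}(z, Y) dz` for measurable `v`, `s > 0`, `t ≥ 0`, all
  `x, Y` — semigroup law, `wienerPaths (n+1) ≅ wienerLine ⊗ wienerPaths n` along `Fin.cons`,
  `fkWeight_vecCons_cons`, drop the tagged factor (`≤ 1`), Tonelli, Gaussian law.
* (B) deterministic, for `g, F ≥ 0` measurable vanishing off `Λ_L`, level-`K` blocks of side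
  `ℓ = L2^{-K}`, `s > 0`:
  - `heat_le_kerBound`: `sup_{x∈Q_i, z∈Q_{i'}} p_s ≤ kerBound(i,i') = ∏_d A q^{|i_d-i'_d|}`,
    `A = (4πs)^{-1/2}e^{ℓ²/(4s)}`, `q = e^{-ℓ²/(4s)}` (`sq_sub_ge_of_mem_Ico`);
    `sum_kerBound_le`: row/column sums `≤ rowBound s ℓ = (A·2/(1-q))³` (`Fintype.prod_sum` +
    geometric lattice sums `sum_pow_dist_le`);
  - `schur_sq_le` / `schur_op_sq_le`: discrete Schur tests in `[0, ∞]` (bilinear / operator form);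
  - `lintegral_mul_heat_le_sum`: `∫ g·P_sF ≤ Σ_{Q,Q'} kerBound a_Q b_{Q'}`;
    `sq_lintegral_sq_le`: `g ≤ P_sF ⟹ (∫g²)² ≤ R² S_K(g) S_K(F)`;
    `uvParticipation_sq_le`: `g ≤ P_sF ⟹ r̄_K(g)² ≤ ℓ⁶ R² S_K(F)/S_K(g)` (junk cases included);
  - `levelSq_smooth_le` / `levelSq_le_levelSq_smooth`: `(κℓ³)² S_K(F) ≤ S_K(P_sF) ≤ ℓ⁶R² S_K(F)`,
    `κ = kerFloor s ℓ` — the two readings of the majorant's block masses are equivalent;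
  - unit-scale uniformity: `half_lt_div_pow_depth`, `div_pow_depth_le_one`
    (`ℓ = L2^{-depth L} ∈ (1/2, 1]` for `L ≥ 1` — sharper than the Defs docstring's `(1/4, 1]`),
    `rowBound_le_rowBound₁`, `rowBound₁_ne_top`; `one_le_sideLength` (eventually `L ≥ 1`).
* Normalisation glue (copies, renamed, of the pending `…SiblingCompose` lemmas):
  `slice_witness_eq_const_mul`, `uvParticipation_smul`, `witness_eq_zero_of_normSq`.
* `uvFlatness_of_blockMassComparison` (constant `C ↦ (R₁(s)² + 1)·C`).

## The missing input (iii) and why it does not close here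

`BlockMassComparison` (below): `∃ s ∈ (0,1], C`, eventually in `n`, `∀ T ≥ 1`:
`∫ m(Y) · S_K(F_Y)/S_K(g_Y) dY ≤ C ‖Z_T‖₂²` with `g_Y = Z_T(·::Y)`, `m = ∫ g_Y²`,
`F_Y = F_{s,T-s}(·, Y)`, `S_K = levelSq · L (depth L)`. Equivalent (by `levelSq_smooth_le`,
`levelSq_le_levelSq_smooth`) to the same statement with `F_Y` replaced by
`G̃_Y = P_sF_Y = E_{x::Y}[w^bath_s · Z_{T-s}(X_s)]` = "`Z_T(x::Y)` with the TAGGED factor (Dirichlet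
survival of line `0` and `e^{-∫₀ˢ Σ_j v(|B⁰-Bʲ|)}`) removed on `[0, s]`", so (iii) says: re-inserting
the tagged weight over one unit of time costs `O(1)` in the `ℓ²`-norm of unit-block masses,
on `m`-average. By the bath's Markov property both `g` and `G̃` are averages over the SAME
un-normalised bath law `μ̃_Y = fkWeight v L T Y ωb dW_n(ωb)` of tagged functionals
`τ_{[0,T]}(x;ωb) ≤ τ_{[s,T]}(x;ωb)`. A proof needs (I1) on blocks free of bath particles within
distance `D`: `∫_Q g ≥ c ∫_Q G̃_near` — a lower bound on "no bath line intrudes into the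
`D/2`-neighbourhood of `Q` during `[0,s]`" under the `τ_{[s,T]}`-TILTED bath law (the tilt
`w^bath_T · Z`-future can favour expansion of a jammed neighbourhood into the free block: the
Wiener-measure Gaussian tail `e^{-D²/(4s)}` per line does not transfer without a bound on the
future-weight ratio, i.e. local crowding control), and (I2) blocks violating the (multiscale)
freeness condition carry a small share of `S_K(G̃)` in `m`-mean. Both are no-crowding /
superstability-type statements for the `(n+1)`-line Feynman–Kac measure under the slice law,
uniform in `n` and `T` — absent from the tree (no local particle-number bounds for `fkWeight dW`,
no quantum superstability), and the same missing technology as the engine crux 9687. Checks: free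
gas `v = 0`: everything factorises, `S_K(F_Y)/S_K(g_Y) = [S¹(φ_{T-s})/S¹(φ_T)]³` is
`Y`-independent (`φ_t(x) = P_x(τ_{(0,L)} > t)`, `S¹` = 1D block sums), and
`φ_T(x)/φ_{T-s}(x) = E_x[φ_s(B_{T-s}) | τ > T-s] ≥ c(s) > 0` uniformly in `x`, `T ≥ 1`, `L ≥ 1`
(the endpoint given survival for time `T - s ≥ 1/2` lies within `√s` of the wall with conditional
probability `O(s)`), so the ratio is `≤ c(s)^{-6}`: (iii) holds with `C = C(s)`; hard cores,
a block crowded by `k` bath particles: `∫_Q g` and `∫_Q F` are BOTH of relative size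
`e^{-R√(kv)}` (escape cost) against free blocks, consistent with an `O(1)` ratio of the SUMS.
No counterexample to (iii) found; it is stronger than `UVFlatness` needs only through taking the
`m`-MEAN of the ratio `S_K(F)/S_K(g)` (an ess-sup version would give wave 1's `PartitionUVBound`
by the same reduction).

Wave 1's statement audit (`work/stubs/stub_uvFlatness.lean`) stands: no junk/vacuity/falsity in
`UVFlatness`; its local copies of the Defs vocabulary are superseded by the import above.
-/

noncomputable section

open MeasureTheory ProbabilityTheory Filter Set Finset
open scoped ENNReal NNReal Topology BigOperators

namespace Summit.AtomisticToContinuum.BoseEinsteinCondensation.Cruxes.LandscapeBound.SiblingTelescopingChaining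

open Literature.MathematicalPhysics.QuantumManyBody.BoseGas
open Literature.Probability.Process (brownian measurable_brownian preWienerMeasure)
open Summit.AtomisticToContinuum.BoseEinsteinCondensation.Theses.BECCutLineWeakDisorder
open Summit.AtomisticToContinuum.BoseEinsteinCondensation.Cruxes.TwoReplicaTransienceBound.TracerDecoupling

/-! ### R3 deterministic part -/

namespace UVFlatnessR3

variable {n : ℕ}

/-- The one-line free heat kernel
`p_s(x, z) = ∏_k gaussianPDF (x_k) (2s) (z_k) = (4πs)^{-3/2} e^{-|x-z|²/(4s)}` on `ℝ³`: the density
at `z` of the tagged world-line `x + √2 b_s` (speed-`2` Brownian motion), the `N = 1` instance of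
the tree's `∏ i, ∏ k, gaussianPDF (X i k) (2t) (Y i k)` (`GroundStateFeynmanKacGaussian.map_worldLine`). -/
def heat (s : ℝ≥0) (x z : Space) : ℝ≥0∞ := ∏ k : Fin 3, gaussianPDF (x k) (2 * s) (z k)

theorem heat_apply (s : ℝ≥0) (x z : Space) :
    heat s x z = ∏ k : Fin 3, gaussianPDF (x k) (2 * s) (z k) :=
  rfl

/-- Translation form of the heat kernel: `p_s(x, z) = ∏_k gaussianPDF 0 (2s) (z_k - x_k)`. -/
theorem heat_eq_sub (s : ℝ≥0) (x z : Space) :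
    heat s x z = ∏ k : Fin 3, gaussianPDF 0 (2 * s) (z k - x k) := by
  unfold heat
  refine Finset.prod_congr rfl fun k _ => ?_
  simp only [gaussianPDF]
  rw [gaussianPDFReal_sub, zero_add]

/-- The heat kernel is jointly measurable. -/
theorem measurable_heat_uncurry (s : ℝ≥0) : Measurable fun p : Space × Space => heat s p.1 p.2 := by
  simp_rw [heat_eq_sub]
  refine Finset.measurable_prod _ fun k _ => ?_
  exact (measurable_gaussianPDF 0 _).comp
    (((measurable_pi_apply k).comp ((WithLp.measurable_ofLp 2 _).comp measurable_snd)).sub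
      ((measurable_pi_apply k).comp ((WithLp.measurable_ofLp 2 _).comp measurable_fst)))

/-- The heat kernel is measurable in the arrival point. -/
theorem measurable_heat (s : ℝ≥0) (x : Space) : Measurable (heat s x) := by
  change Measurable ((fun p : Space × Space => heat s p.1 p.2) ∘ Prod.mk x)
  exact (measurable_heat_uncurry s).comp measurable_prodMk_left

/-- The heat kernel is measurable in the starting point. -/
theorem measurable_heat_left (s : ℝ≥0) (z : Space) : Measurable fun x => heat s x z := by
  change Measurable ((fun p : Space × Space => heat s p.1 p.2) ∘ fun x => (x, z))
  exact (measurable_heat_uncurry s).comp measurable_prodMk_right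

/-- **The heat kernel is bounded by its peak**: `p_s(x, z) ≤ (4πs)^{-3/2}` (product form). -/
theorem heat_le_peak (s : ℝ≥0) (x z : Space) :
    heat s x z ≤ ∏ _k : Fin 3, ENNReal.ofReal (Real.sqrt (2 * Real.pi * (2 * s)))⁻¹ := by
  have h := heatKernel_le (N := 1) (fun _ => x) (fun _ => z) s
  simpa [heat, Fin.prod_univ_one] using h

/-- **The free one-line expectation as an integral against the heat kernel**: for measurable
`G : ℝ³ → [0, ∞]` and `s > 0`, `E[G(x + √2 b_s)] = ∫ p_s(x, z) G(z) dz` (the `N = 1` case of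
`lintegral_worldLine_eq`, transported along `(Fin 1 → α) ≃ α`). -/
theorem lintegral_wienerLine_eq (x : Space) {s : ℝ≥0} (hs : s ≠ 0) {G : Space → ℝ≥0∞}
    (hG : Measurable G) :
    ∫⁻ ω₀, G (x + WithLp.toLp 2 (fun k => Real.sqrt 2 * brownian s (ω₀ k))) ∂wienerLine =
      ∫⁻ z, heat s x z * G z := by
  have h1 := lintegral_worldLine_eq (N := 1) (fun _ => x) hs (F := fun Y => G (Y 0))
    (hG.comp (measurable_pi_apply 0))
  have hmp := measurePreserving_funUnique wienerLine (Fin 1)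
  have hvol := volume_preserving_funUnique (Fin 1) Space
  have hL : ∫⁻ ω₀, G (x + WithLp.toLp 2 (fun k => Real.sqrt 2 * brownian s (ω₀ k))) ∂wienerLine =
      ∫⁻ ω, G (worldLine (N := 1) (fun _ => x) ω s 0) ∂wienerPaths 1 := by
    rw [← hmp.lintegral_comp_emb (MeasurableEquiv.measurableEmbedding _)]
    rfl
  have hR : ∫⁻ z, heat s x z * G z =
      ∫⁻ Y : Config 1, (∏ i, ∏ k, gaussianPDF ((fun _ : Fin 1 => x) i k) (2 * s) (Y i k)) * G (Y 0) := by
    rw [← hvol.lintegral_comp_emb (MeasurableEquiv.measurableEmbedding _)]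
    refine lintegral_congr fun Y => ?_
    simp [heat, MeasurableEquiv.funUnique, Fin.default_eq_zero]
  rw [hL, hR, h1]

/-- The `(n+1)`-line world-line of `x :: Y` along `Fin.cons ω₀ ωb` is the tagged line consed onto the
bath world-lines. -/
theorem worldLine_vecCons_cons (x : Space) (Y : Config n) (ω₀ : Fin 3 → (ℝ≥0 → ℝ))
    (ωb : PathSpace n) (s : ℝ≥0) :
    worldLine (Matrix.vecCons x Y) (Fin.cons ω₀ ωb) s =
      Matrix.vecCons (x + WithLp.toLp 2 (fun k => Real.sqrt 2 * brownian s (ω₀ k)))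
        (worldLine Y ωb s) := by
  funext i
  refine Fin.cases ?_ (fun j => ?_) i
  · simp [worldLine]
  · simp [worldLine]

/-- **The one-step bath majorant** `F_{s,t}(z, Y) = ∫ fkWeight v L s Y ωb · Z_t(z :: B^bath_s(ωb)) dW_n(ωb)`:
the bath evolves for time `s` with its own killed, interaction-weighted law, and a fresh tagged
particle is inserted at `z` at time `s` for the remaining time `t` (`Z_t = fkPartition v L t`). -/
def stepMajorant (v : ℝ → ℝ≥0∞) (L s t : ℝ) (Y : Config n) (z : Space) : ℝ≥0∞ :=
  ∫⁻ ωb, fkWeight v L s Y ωb *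
    fkPartition v L t (Matrix.vecCons z (worldLine Y ωb s.toNNReal)) ∂wienerPaths n

/-- Joint measurability of the integrand of the step majorant in `(z, ωb)`. -/
theorem measurable_stepIntegrand {v : ℝ → ℝ≥0∞} (hv : Measurable v) (L s t : ℝ) (Y : Config n) :
    Measurable fun q : Space × PathSpace n => fkWeight v L s Y q.2 *
      fkPartition v L t (Matrix.vecCons q.1 (worldLine Y q.2 s.toNNReal)) := by
  refine ((measurable_fkWeight hv L s Y).comp measurable_snd).mul ?_
  have hZ : Measurable (fkPartition (N := n + 1) v L t) := measurable_fkSemigroup hv L t measurable_const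
  exact hZ.comp (measurable_vecCons.comp
    (measurable_fst.prodMk ((measurable_worldLine Y _).comp measurable_snd)))

/-- The step majorant is measurable in the insertion point. -/
theorem measurable_stepMajorant {v : ℝ → ℝ≥0∞} (hv : Measurable v) (L s t : ℝ) (Y : Config n) :
    Measurable (stepMajorant v L s t Y) :=
  (measurable_stepIntegrand hv L s t Y).lintegral_prod_right'

/-- The step majorant vanishes off the open box (the inserted tagged particle is killed at once). -/
theorem stepMajorant_of_notMem (v : ℝ → ℝ≥0∞) (L s : ℝ) {t : ℝ} (ht : 0 ≤ t) (Y : Config n)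
    {z : Space} (hz : z ∉ box L) : stepMajorant v L s t Y z = 0 := by
  unfold stepMajorant
  have h0 : ∀ ωb : PathSpace n,
      fkPartition v L t (Matrix.vecCons z (worldLine Y ωb s.toNNReal)) = 0 := by
    intro ωb
    refine fkSemigroup_of_notMem v ht _ fun hX => hz ?_
    simpa using hX 0
  simp [h0]

/-- **(A) One-step Gaussian domination of the tagged slice.** For measurable `v`, `s > 0`, `t ≥ 0`
and every bath configuration `Y`:
`Z_{s+t}(x :: Y) ≤ ∫ p_s(x, z) F_{s,t}(z, Y) dz`, where `Z = fkPartition v L ·`, `p_s` is the free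
one-line heat kernel (`heat`) and `F_{s,t}` the one-step bath majorant (`stepMajorant`). Proof: the
semigroup law `Z_{s+t} = e^{-sH} Z_t` (`fkPartition_add`), the disintegration
`wienerPaths (n+1) ≅ wienerLine ⊗ wienerPaths n` along `Fin.cons`
(`measurePreserving_piFinSuccAbove_wienerPaths`), the pointwise factorisation of the weight of
`x :: Y` into the bath weight times the tagged factor (`fkWeight_vecCons_cons`), DROPPING the
tagged factor (`≤ 1`: survival indicator times `e^{-(tagged–bath action)}`), Tonelli, and the
Gaussian law of the tagged endpoint `x + √2 b_s` (`lintegral_wienerLine_eq`). -/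
theorem fkPartition_vecCons_le_gaussian_step {v : ℝ → ℝ≥0∞} (hv : Measurable v) (L : ℝ) {s : ℝ}
    (hs : 0 < s) {t : ℝ} (ht : 0 ≤ t) (x : Space) (Y : Config n) :
    fkPartition v L (s + t) (Matrix.vecCons x Y) ≤
      ∫⁻ z, heat s.toNNReal x z * stepMajorant v L s t Y z := by
  have hs' : s.toNNReal ≠ 0 := by simpa [Real.toNNReal_eq_zero] using hs
  rw [fkPartition_add hv L hs.le ht]
  rw [fkSemigroup]
  set e := MeasurableEquiv.piFinSuccAbove (fun _ : Fin (n + 1) => Fin 3 → (ℝ≥0 → ℝ)) 0 with he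
  have hmp : MeasurePreserving e (wienerPaths (n + 1)) (wienerLine.prod (wienerPaths n)) :=
    TracerFactorisation.measurePreserving_piFinSuccAbove_wienerPaths n
  rw [← hmp.symm.lintegral_comp_emb e.symm.measurableEmbedding]
  -- the tagged displacement `ω₀ ↦ √2 b_s(ω₀) ∈ ℝ³` is measurable
  have hD : Measurable fun ω₀ : Fin 3 → (ℝ≥0 → ℝ) =>
      WithLp.toLp 2 (fun k : Fin 3 => Real.sqrt 2 * brownian s.toNNReal (ω₀ k)) :=
    (WithLp.measurable_toLp 2 _).comp (measurable_pi_lambda _ fun k =>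
      ((measurable_brownian _).const_mul _).comp (measurable_pi_apply k))
  have hG := measurable_stepIntegrand hv L s t Y
  have hφ : Measurable fun p : (Fin 3 → (ℝ≥0 → ℝ)) × PathSpace n =>
      (x + WithLp.toLp 2 (fun k : Fin 3 => Real.sqrt 2 * brownian s.toNNReal (p.1 k)), p.2) :=
    ((hD.comp measurable_fst).const_add x).prodMk measurable_snd
  have hint : Measurable fun p : (Fin 3 → (ℝ≥0 → ℝ)) × PathSpace n => fkWeight v L s Y p.2 *
      fkPartition v L t (Matrix.vecCons
        (x + WithLp.toLp 2 (fun k : Fin 3 => Real.sqrt 2 * brownian s.toNNReal (p.1 k)))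
        (worldLine Y p.2 s.toNNReal)) := by
    have h := hG.comp hφ
    exact h
  -- pointwise: drop the tagged factor
  have hpt : ∀ p : (Fin 3 → (ℝ≥0 → ℝ)) × PathSpace n,
      fkWeight v L s (Matrix.vecCons x Y) (e.symm p) *
          fkPartition v L t (worldLine (Matrix.vecCons x Y) (e.symm p) s.toNNReal) ≤
        fkWeight v L s Y p.2 * fkPartition v L t (Matrix.vecCons
          (x + WithLp.toLp 2 (fun k : Fin 3 => Real.sqrt 2 * brownian s.toNNReal (p.1 k)))
          (worldLine Y p.2 s.toNNReal)) := by
    intro p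
    rw [he, TracerFactorisation.piFinSuccAbove_symm_apply_eq_cons,
      TracerFactorisation.fkWeight_vecCons_cons hv, worldLine_vecCons_cons]
    refine mul_le_mul' ?_ le_rfl
    calc fkWeight v L s Y p.2 *
          ((survives (N := 1) L s (fun _ => x)).indicator (fun _ => (1 : ℝ≥0∞)) (fun _ => p.1) *
            expNeg (taggedBathAction v s x Y p.1 p.2))
        ≤ fkWeight v L s Y p.2 * (1 * 1) :=
          mul_le_mul' le_rfl (mul_le_mul' (Set.indicator_le_self' (fun _ _ => bot_le) _)
            (expNeg_le_one _))
      _ = fkWeight v L s Y p.2 := by rw [one_mul, mul_one]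
  refine (lintegral_mono hpt).trans ?_
  rw [lintegral_prod _ hint.aemeasurable]
  -- the inner integral is the step majorant at the tagged endpoint; then the Gaussian law
  have hF : Measurable (stepMajorant v L s t Y) := measurable_stepMajorant hv L s t Y
  exact (lintegral_wienerLine_eq x hs' hF).le

/-! #### (B) The deterministic smoothing–block inequality

For `g ≤ P_s F` (`P_s` = free heat semigroup at time `s`) with `g, F ≥ 0` vanishing off `Λ_L`, and
the level-`K` dyadic blocks `Q` of side `ℓ = L2^{-K}`:
`(∫ g²)² ≤ (∫ g · P_sF)² ≤ R(s,ℓ)² · Σ_Q (∫_Q g)² · Σ_Q (∫_Q F)²`, whence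
`r̄_K(g)² ≤ ℓ⁶ R² · Σ_Q(∫_Q F)² / Σ_Q(∫_Q g)²` — a discrete Schur test for the Gaussian kernel
maximised over pairs of blocks (`heat_le_kerBound`, geometric row sums `sum_kerBound_le`). -/

/-- `(x^{1/2})² = x` in `[0, ∞]`. -/
theorem rpow_half_sq (x : ℝ≥0∞) : (x ^ (1 / 2 : ℝ)) ^ 2 = x := by
  rw [← ENNReal.rpow_natCast, ← ENNReal.rpow_mul]
  norm_num

/-- **Discrete Schur test (squared form).** For a kernel `K ≥ 0` on a finite index set whose row
and column sums are at most `M`: `(Σ_i Σ_{i'} K(i,i') a_i b_{i'})² ≤ M² (Σ a²)(Σ b²)`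
(Cauchy–Schwarz on `ι × ι` with `K a b = (K^{1/2}a)(K^{1/2}b)`). -/
theorem schur_sq_le {ι : Type*} [Fintype ι] (Kf : ι → ι → ℝ≥0∞) (a b : ι → ℝ≥0∞) (M : ℝ≥0∞)
    (hrow : ∀ i, ∑ i', Kf i i' ≤ M) (hcol : ∀ i', ∑ i, Kf i i' ≤ M) :
    (∑ i, ∑ i', Kf i i' * (a i * b i')) ^ 2 ≤ M ^ 2 * ((∑ i, a i ^ 2) * ∑ i', b i' ^ 2) := by
  classical
  set f : ι × ι → ℝ≥0∞ := fun p => Kf p.1 p.2 ^ (1 / 2 : ℝ) * a p.1 with hf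
  set g : ι × ι → ℝ≥0∞ := fun p => Kf p.1 p.2 ^ (1 / 2 : ℝ) * b p.2 with hg
  have hfg : ∀ p, f p * g p = Kf p.1 p.2 * (a p.1 * b p.2) := by
    intro p
    simp only [hf, hg]
    calc Kf p.1 p.2 ^ (1 / 2 : ℝ) * a p.1 * (Kf p.1 p.2 ^ (1 / 2 : ℝ) * b p.2)
        = (Kf p.1 p.2 ^ (1 / 2 : ℝ)) ^ 2 * (a p.1 * b p.2) := by ring
      _ = _ := by rw [rpow_half_sq]
  have hsum : ∑ i, ∑ i', Kf i i' * (a i * b i') = ∑ p : ι × ι, f p * g p := by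
    rw [Fintype.sum_prod_type]
    simp only [hfg]
  have hCS := ENNReal.inner_le_Lp_mul_Lq (Finset.univ : Finset (ι × ι)) f g
    Real.HolderConjugate.two_two
  have hf2 : ∑ p : ι × ι, f p ^ (2 : ℝ) ≤ M * ∑ i, a i ^ 2 := by
    calc ∑ p : ι × ι, f p ^ (2 : ℝ) = ∑ i, ∑ i', Kf i i' * a i ^ 2 := by
          rw [Fintype.sum_prod_type]
          refine Finset.sum_congr rfl fun i _ => Finset.sum_congr rfl fun i' _ => ?_
          simp only [hf, ENNReal.rpow_two, mul_pow, rpow_half_sq]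
      _ = ∑ i, a i ^ 2 * ∑ i', Kf i i' := by
          refine Finset.sum_congr rfl fun i _ => ?_
          rw [Finset.mul_sum]
          refine Finset.sum_congr rfl fun i' _ => ?_
          ring
      _ ≤ ∑ i, a i ^ 2 * M := Finset.sum_le_sum fun i _ => mul_le_mul' le_rfl (hrow i)
      _ = M * ∑ i, a i ^ 2 := by rw [← Finset.sum_mul, mul_comm]
  have hg2 : ∑ p : ι × ι, g p ^ (2 : ℝ) ≤ M * ∑ i', b i' ^ 2 := by
    calc ∑ p : ι × ι, g p ^ (2 : ℝ) = ∑ i, ∑ i', Kf i i' * b i' ^ 2 := by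
          rw [Fintype.sum_prod_type]
          refine Finset.sum_congr rfl fun i _ => Finset.sum_congr rfl fun i' _ => ?_
          simp only [hg, ENNReal.rpow_two, mul_pow, rpow_half_sq]
      _ = ∑ i', b i' ^ 2 * ∑ i, Kf i i' := by
          rw [Finset.sum_comm]
          refine Finset.sum_congr rfl fun i' _ => ?_
          rw [Finset.mul_sum]
          refine Finset.sum_congr rfl fun i _ => ?_
          ring
      _ ≤ ∑ i', b i' ^ 2 * M := Finset.sum_le_sum fun i' _ => mul_le_mul' le_rfl (hcol i')
      _ = M * ∑ i', b i' ^ 2 := by rw [← Finset.sum_mul, mul_comm]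
  rw [hsum]
  calc (∑ p : ι × ι, f p * g p) ^ 2
      ≤ ((∑ p : ι × ι, f p ^ (2 : ℝ)) ^ (1 / (2 : ℝ)) *
          (∑ p : ι × ι, g p ^ (2 : ℝ)) ^ (1 / (2 : ℝ))) ^ 2 := pow_le_pow_left' hCS 2
    _ = (∑ p : ι × ι, f p ^ (2 : ℝ)) * (∑ p : ι × ι, g p ^ (2 : ℝ)) := by
        rw [mul_pow, rpow_half_sq, rpow_half_sq]
    _ ≤ (M * ∑ i, a i ^ 2) * (M * ∑ i', b i' ^ 2) := mul_le_mul' hf2 hg2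
    _ = M ^ 2 * ((∑ i, a i ^ 2) * ∑ i', b i' ^ 2) := by ring

/-- **Geometric lattice sums**: `Σ_{j < N} r^{|a - j|} ≤ 2 (1 - r)⁻¹` in `[0, ∞]` (split `j ≤ a`,
`j > a`; each part injects into `Σ_m r^m = (1 - r)⁻¹`). -/
theorem sum_pow_dist_le (N a : ℕ) (r : ℝ≥0∞) :
    ∑ j : Fin N, r ^ Nat.dist a j ≤ 2 * (1 - r)⁻¹ := by
  classical
  rw [← ENNReal.tsum_geometric, two_mul]
  set A : Finset (Fin N) := Finset.univ.filter (fun j : Fin N => (j : ℕ) ≤ a) with hA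
  set B : Finset (Fin N) := Finset.univ.filter (fun j : Fin N => ¬ (j : ℕ) ≤ a) with hB
  have h1 : ∑ j ∈ A, r ^ Nat.dist a j ≤ ∑' m : ℕ, r ^ m := by
    have hinj : Set.InjOn (fun j : Fin N => a - (j : ℕ)) ↑A := by
      intro j hj j' hj' h
      simp only [hA, Finset.coe_filter, Finset.mem_univ, true_and, Set.mem_setOf_eq] at hj hj'
      exact Fin.ext (by dsimp at h; omega)
    calc ∑ j ∈ A, r ^ Nat.dist a j = ∑ j ∈ A, r ^ (a - (j : ℕ)) := by
          refine Finset.sum_congr rfl fun j hj => ?_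
          rw [Nat.dist_eq_sub_of_le_right (Finset.mem_filter.1 hj).2]
      _ = ∑ m ∈ A.image (fun j : Fin N => a - (j : ℕ)), r ^ m := (Finset.sum_image hinj).symm
      _ ≤ ∑' m : ℕ, r ^ m := ENNReal.sum_le_tsum _
  have h2 : ∑ j ∈ B, r ^ Nat.dist a j ≤ ∑' m : ℕ, r ^ m := by
    have hinj : Set.InjOn (fun j : Fin N => (j : ℕ) - a) ↑B := by
      intro j hj j' hj' h
      simp only [hB, Finset.coe_filter, Finset.mem_univ, true_and, Set.mem_setOf_eq] at hj hj'
      exact Fin.ext (by dsimp at h; omega)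
    calc ∑ j ∈ B, r ^ Nat.dist a j = ∑ j ∈ B, r ^ ((j : ℕ) - a) := by
          refine Finset.sum_congr rfl fun j hj => ?_
          rw [Nat.dist_eq_sub_of_le (le_of_not_ge (Finset.mem_filter.1 hj).2)]
      _ = ∑ m ∈ B.image (fun j : Fin N => (j : ℕ) - a), r ^ m := (Finset.sum_image hinj).symm
      _ ≤ ∑' m : ℕ, r ^ m := ENNReal.sum_le_tsum _
  calc ∑ j : Fin N, r ^ Nat.dist a j
      = (∑ j ∈ A, r ^ Nat.dist a j) + ∑ j ∈ B, r ^ Nat.dist a j :=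
        (Finset.sum_filter_add_sum_filter_not _ _ _).symm
    _ ≤ _ := add_le_add h1 h2

/-- The peak of the one-line heat kernel times the one-block slack:
`A(s, ℓ) = (4πs)^{-1/2} e^{ℓ²/(4s)}` (per coordinate). -/
def kerConst (s : ℝ≥0) (ℓ : ℝ) : ℝ := (Real.sqrt (2 * Real.pi * (2 * s)))⁻¹ * Real.exp (ℓ ^ 2 / (4 * s))

/-- The per-block Gaussian decay ratio `q(s, ℓ) = e^{-ℓ²/(4s)} ∈ (0, 1)` (per coordinate). -/
def kerRatio (s : ℝ≥0) (ℓ : ℝ) : ℝ := Real.exp (-(ℓ ^ 2 / (4 * s)))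

theorem kerConst_pos (s : ℝ≥0) (ℓ : ℝ) (hs : s ≠ 0) : 0 < kerConst s ℓ := by
  unfold kerConst
  have : (0 : ℝ) < s := by exact_mod_cast pos_iff_ne_zero.2 hs
  positivity

theorem kerRatio_pos (s : ℝ≥0) (ℓ : ℝ) : 0 < kerRatio s ℓ := Real.exp_pos _

theorem kerRatio_lt_one {s : ℝ≥0} (hs : s ≠ 0) {ℓ : ℝ} (hℓ : ℓ ≠ 0) : kerRatio s ℓ < 1 := by
  unfold kerRatio
  have hs' : (0 : ℝ) < s := by exact_mod_cast pos_iff_ne_zero.2 hs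
  rw [Real.exp_lt_one_iff]
  have : 0 < ℓ ^ 2 / (4 * s) := by positivity
  linarith

/-- **The block kernel**: the sup over `x ∈ Q_i`, `z ∈ Q_{i'}` of the heat kernel is at most
`kerBound s ℓ i i' = ∏_d A(s,ℓ) q(s,ℓ)^{|i_d - i'_d|}`. -/
def kerBound (s : ℝ≥0) (ℓ : ℝ) {K : ℕ} (i i' : Fin 3 → Fin (2 ^ K)) : ℝ≥0∞ :=
  ∏ d : Fin 3, ENNReal.ofReal (kerConst s ℓ * kerRatio s ℓ ^ Nat.dist (i d) (i' d))

/-- The block kernel is symmetric. -/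
theorem kerBound_comm (s : ℝ≥0) (ℓ : ℝ) {K : ℕ} (i i' : Fin 3 → Fin (2 ^ K)) :
    kerBound s ℓ i i' = kerBound s ℓ i' i := by
  unfold kerBound
  simp_rw [Nat.dist_comm (i _ : ℕ)]

/-- The uniform row/column bound of the block kernel: `R(s, ℓ) = (A(s,ℓ) · 2/(1 - q(s,ℓ)))³`. -/
def rowBound (s : ℝ≥0) (ℓ : ℝ) : ℝ≥0∞ :=
  (ENNReal.ofReal (kerConst s ℓ) * (2 * (1 - ENNReal.ofReal (kerRatio s ℓ))⁻¹)) ^ 3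

/-- **Row sums of the block kernel**: `Σ_{i'} kerBound s ℓ i i' ≤ R(s, ℓ)` (the sum over the
product index set factorises over the three coordinates; each factor is a geometric lattice sum). -/
theorem sum_kerBound_le (s : ℝ≥0) (ℓ : ℝ) {K : ℕ} (i : Fin 3 → Fin (2 ^ K)) :
    ∑ i', kerBound s ℓ i i' ≤ rowBound s ℓ := by
  classical
  have hprod := Fintype.prod_sum
    (fun (d : Fin 3) (j : Fin (2 ^ K)) => ENNReal.ofReal (kerConst s ℓ * kerRatio s ℓ ^ Nat.dist (i d) j))
  unfold kerBound
  rw [← hprod]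
  unfold rowBound
  have h3 : (ENNReal.ofReal (kerConst s ℓ) * (2 * (1 - ENNReal.ofReal (kerRatio s ℓ))⁻¹)) ^ 3 =
      ∏ _d : Fin 3, ENNReal.ofReal (kerConst s ℓ) * (2 * (1 - ENNReal.ofReal (kerRatio s ℓ))⁻¹) := by
    rw [Finset.prod_const, Finset.card_univ, Fintype.card_fin]
  rw [h3]
  refine Finset.prod_le_prod' fun d _ => ?_
  have hq : 0 ≤ kerRatio s ℓ := (kerRatio_pos s ℓ).le
  calc ∑ j : Fin (2 ^ K), ENNReal.ofReal (kerConst s ℓ * kerRatio s ℓ ^ Nat.dist (i d) j)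
      = ∑ j : Fin (2 ^ K), ENNReal.ofReal (kerConst s ℓ) *
          ENNReal.ofReal (kerRatio s ℓ) ^ Nat.dist (i d) j := by
        refine Finset.sum_congr rfl fun j _ => ?_
        rw [ENNReal.ofReal_mul (by unfold kerConst; positivity), ENNReal.ofReal_pow hq]
    _ = ENNReal.ofReal (kerConst s ℓ) * ∑ j : Fin (2 ^ K), ENNReal.ofReal (kerRatio s ℓ) ^ Nat.dist (i d) j := by
        rw [Finset.mul_sum]
    _ ≤ ENNReal.ofReal (kerConst s ℓ) * (2 * (1 - ENNReal.ofReal (kerRatio s ℓ))⁻¹) :=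
        mul_le_mul' le_rfl (sum_pow_dist_le _ _ _)

/-- Column sums of the block kernel (by symmetry). -/
theorem sum_kerBound_le' (s : ℝ≥0) (ℓ : ℝ) {K : ℕ} (i' : Fin 3 → Fin (2 ^ K)) :
    ∑ i, kerBound s ℓ i i' ≤ rowBound s ℓ := by
  simp_rw [kerBound_comm s ℓ _ i']
  exact sum_kerBound_le s ℓ i'

/-- **One-dimensional block separation.** Points of the `a`-th and `b`-th intervals of length `ℓ`
are at squared distance `≥ ℓ² (|a - b| - 1)`. -/
theorem sq_sub_ge_of_mem_Ico {ℓ : ℝ} {a b : ℕ} {u w : ℝ}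
    (hu : u ∈ Set.Ico (ℓ * a) (ℓ * (a + 1))) (hw : w ∈ Set.Ico (ℓ * b) (ℓ * (b + 1))) :
    ℓ ^ 2 * ((Nat.dist a b : ℝ) - 1) ≤ (w - u) ^ 2 := by
  have hℓ : 0 < ℓ := by
    have := hu.1.trans_lt hu.2
    nlinarith
  rcases Nat.eq_zero_or_pos (Nat.dist a b) with h0 | hpos
  · simp only [h0, Nat.cast_zero]
    nlinarith [sq_nonneg (w - u), sq_nonneg ℓ]
  -- `m = |a - b| ≥ 1`; write `m = k + 1`
  obtain ⟨k, hk⟩ : ∃ k : ℕ, Nat.dist a b = k + 1 := ⟨Nat.dist a b - 1, by omega⟩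
  have hk2 : (k : ℝ) ≤ (k : ℝ) ^ 2 := by
    have : k ≤ k ^ 2 := Nat.le_self_pow two_ne_zero k
    exact_mod_cast this
  have hcast : ((Nat.dist a b : ℕ) : ℝ) - 1 = k := by
    rw [hk]; push_cast; ring
  rw [hcast]
  rcases le_total a b with hab | hab
  · -- `b = a + k + 1`, `w - u ≥ ℓ k`
    have hb : (b : ℝ) = a + k + 1 := by
      have : b = a + (k + 1) := by
        have := Nat.dist_eq_sub_of_le hab; omega
      rw [this]; push_cast; ring
    have h1 : ℓ * k ≤ w - u := by
      have hw1 := hw.1; have hu2 := hu.2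
      rw [hb] at hw1
      nlinarith
    have h0k : 0 ≤ ℓ * k := by positivity
    calc ℓ ^ 2 * (k : ℝ) ≤ ℓ ^ 2 * (k : ℝ) ^ 2 := by nlinarith [sq_nonneg ℓ]
      _ = (ℓ * k) ^ 2 := by ring
      _ ≤ (w - u) ^ 2 := pow_le_pow_left₀ h0k h1 2
  · -- `a = b + k + 1`, `u - w ≥ ℓ k`
    have ha : (a : ℝ) = b + k + 1 := by
      have : a = b + (k + 1) := by
        have := Nat.dist_eq_sub_of_le_right hab; omega
      rw [this]; push_cast; ring
    have h1 : ℓ * k ≤ u - w := by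
      have hu1 := hu.1; have hw2 := hw.2
      rw [ha] at hu1
      nlinarith
    have h0k : 0 ≤ ℓ * k := by positivity
    calc ℓ ^ 2 * (k : ℝ) ≤ ℓ ^ 2 * (k : ℝ) ^ 2 := by nlinarith [sq_nonneg ℓ]
      _ = (ℓ * k) ^ 2 := by ring
      _ ≤ (u - w) ^ 2 := pow_le_pow_left₀ h0k h1 2
      _ = (w - u) ^ 2 := by ring

/-- Membership in a dyadic block, coordinatewise, with `ℓ = L/2^j`. -/
theorem mem_Ico_of_mem_dyadicCube {L : ℝ} {j : ℕ} {i : Fin 3 → Fin (2 ^ j)} {x : Space}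
    (hx : x ∈ dyadicCube L j i) (d : Fin 3) :
    x d ∈ Set.Ico (L / 2 ^ j * (i d : ℕ)) (L / 2 ^ j * ((i d : ℕ) + 1)) := by
  have h := hx d
  simp only [Set.mem_Ico] at h ⊢
  constructor
  · calc L / 2 ^ j * (i d : ℕ) = L * (i d : ℕ) / 2 ^ j := by ring
      _ ≤ x d := h.1
  · calc x d < L * ((i d : ℕ) + 1) / 2 ^ j := h.2
      _ = L / 2 ^ j * ((i d : ℕ) + 1) := by ring

/-- The per-coordinate Gaussian factor between two blocks is bounded by `A q^{|a-b|}`. -/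
theorem exp_le_kerConst_mul {ℓ : ℝ} {a b : ℕ} {u w : ℝ}
    (hu : u ∈ Set.Ico (ℓ * a) (ℓ * (a + 1))) (hw : w ∈ Set.Ico (ℓ * b) (ℓ * (b + 1)))
    {s : ℝ≥0} (hs : s ≠ 0) :
    (Real.sqrt (2 * Real.pi * (2 * s)))⁻¹ * Real.exp (-(w - u) ^ 2 / (2 * (2 * s))) ≤
      kerConst s ℓ * kerRatio s ℓ ^ Nat.dist a b := by
  have hs' : (0 : ℝ) < s := by exact_mod_cast pos_iff_ne_zero.2 hs
  have hsep := sq_sub_ge_of_mem_Ico hu hw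
  have key : Real.exp (-(w - u) ^ 2 / (2 * (2 * (s : ℝ)))) ≤
      Real.exp (ℓ ^ 2 / (4 * s)) * Real.exp (-(ℓ ^ 2 / (4 * s))) ^ Nat.dist a b := by
    rw [← Real.exp_nat_mul, ← Real.exp_add]
    refine Real.exp_le_exp.2 ?_
    rw [show (2 : ℝ) * (2 * s) = 4 * s by ring]
    have h4 : (0 : ℝ) < 4 * s := by positivity
    rw [div_le_iff₀ h4]
    have : (ℓ ^ 2 / (4 * s) + (Nat.dist a b : ℝ) * -(ℓ ^ 2 / (4 * s))) * (4 * s) =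
        -(ℓ ^ 2 * ((Nat.dist a b : ℝ) - 1)) := by
      field_simp
      ring
    rw [this]
    linarith
  unfold kerConst kerRatio
  calc (Real.sqrt (2 * Real.pi * (2 * s)))⁻¹ * Real.exp (-(w - u) ^ 2 / (2 * (2 * s)))
      ≤ (Real.sqrt (2 * Real.pi * (2 * s)))⁻¹ *
          (Real.exp (ℓ ^ 2 / (4 * s)) * Real.exp (-(ℓ ^ 2 / (4 * s))) ^ Nat.dist a b) :=
        mul_le_mul_of_nonneg_left key (inv_nonneg.2 (Real.sqrt_nonneg _))
    _ = _ := by ring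

/-- **The heat kernel between two blocks is bounded by the block kernel.** -/
theorem heat_le_kerBound {L : ℝ} (K : ℕ) {s : ℝ≥0} (hs : s ≠ 0) {i i' : Fin 3 → Fin (2 ^ K)}
    {x z : Space} (hx : x ∈ dyadicCube L K i) (hz : z ∈ dyadicCube L K i') :
    heat s x z ≤ kerBound s (L / 2 ^ K) i i' := by
  unfold heat kerBound
  refine Finset.prod_le_prod' fun d _ => ?_
  rw [gaussianPDF, gaussianPDFReal]
  refine ENNReal.ofReal_le_ofReal ?_
  have h := exp_le_kerConst_mul (mem_Ico_of_mem_dyadicCube hx d) (mem_Ico_of_mem_dyadicCube hz d) hs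
  push_cast
  exact h

/-- **(B, bilinear form) The smoothing–block inequality.** For measurable `g, F ≥ 0` vanishing off
`Λ_L` (`L > 0`) and `s > 0`:
`∫ g · (P_s F) ≤ Σ_Q Σ_{Q'} kerBound(Q, Q') (∫_Q g)(∫_{Q'} F)` over the level-`K` dyadic blocks. -/
theorem lintegral_mul_heat_le_sum {L : ℝ} (hL : 0 < L) (K : ℕ) {s : ℝ≥0} (hs : s ≠ 0)
    {g F : Space → ℝ≥0∞} (hg : Measurable g) (hF : Measurable F)
    (hg0 : ∀ x, x ∉ box L → g x = 0) (hF0 : ∀ z, z ∉ box L → F z = 0) :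
    ∫⁻ x, g x * ∫⁻ z, heat s x z * F z ≤
      ∑ i, ∑ i', kerBound s (L / 2 ^ K) i i' * (blockMass g L K i * blockMass F L K i') := by
  -- the smoothed function on a block
  have hPF : ∀ i, ∀ x ∈ dyadicCube L K i,
      ∫⁻ z, heat s x z * F z ≤ ∑ i', kerBound s (L / 2 ^ K) i i' * blockMass F L K i' := by
    intro i x hx
    have h1 : ∫⁻ z, heat s x z * F z ≤ ∑ i', blockMass (fun z => heat s x z * F z) L K i' :=
      lintegral_le_sum_blockMass hL (fun z hz => by simp [hF0 z hz]) K
    refine h1.trans (Finset.sum_le_sum fun i' _ => ?_)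
    unfold blockMass
    calc ∫⁻ z in dyadicCube L K i', heat s x z * F z
        ≤ ∫⁻ z in dyadicCube L K i', kerBound s (L / 2 ^ K) i i' * F z :=
          setLIntegral_mono' (measurableSet_dyadicCube L K i') fun z hz =>
            mul_le_mul' (heat_le_kerBound K hs hx hz) le_rfl
      _ = kerBound s (L / 2 ^ K) i i' * ∫⁻ z in dyadicCube L K i', F z :=
          lintegral_const_mul _ hF
  -- sum over the blocks of `x`
  have h2 : ∫⁻ x, g x * ∫⁻ z, heat s x z * F z ≤
      ∑ i, blockMass (fun x => g x * ∫⁻ z, heat s x z * F z) L K i :=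
    lintegral_le_sum_blockMass hL (fun x hx => by simp [hg0 x hx]) K
  refine h2.trans (Finset.sum_le_sum fun i _ => ?_)
  unfold blockMass
  calc ∫⁻ x in dyadicCube L K i, g x * ∫⁻ z, heat s x z * F z
      ≤ ∫⁻ x in dyadicCube L K i, g x * ∑ i', kerBound s (L / 2 ^ K) i i' * blockMass F L K i' :=
        setLIntegral_mono' (measurableSet_dyadicCube L K i) fun x hx =>
          mul_le_mul' le_rfl (hPF i x hx)
    _ = (∫⁻ x in dyadicCube L K i, g x) * ∑ i', kerBound s (L / 2 ^ K) i i' * blockMass F L K i' :=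
        lintegral_mul_const _ hg
    _ = ∑ i', kerBound s (L / 2 ^ K) i i' * (blockMass g L K i * blockMass F L K i') := by
        rw [Finset.mul_sum]
        refine Finset.sum_congr rfl fun i' _ => ?_
        unfold blockMass
        ring

/-- **(B) The smoothing–block inequality.** If moreover `g ≤ P_s F` pointwise (`P_s` the free
one-line heat semigroup), then `(∫ g²)² ≤ (∫ g · P_sF)² ≤ R(s, ℓ)² · S_K(g) · S_K(F)` with
`S_K = levelSq · L K` the sums of squared block masses and `R(s,ℓ) = rowBound s ℓ`, `ℓ = L2^{-K}`
(discrete Schur test `schur_sq_le` with the row sums `sum_kerBound_le`). -/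
theorem sq_lintegral_sq_le {L : ℝ} (hL : 0 < L) (K : ℕ) {s : ℝ≥0} (hs : s ≠ 0)
    {g F : Space → ℝ≥0∞} (hg : Measurable g) (hF : Measurable F)
    (hg0 : ∀ x, x ∉ box L → g x = 0) (hF0 : ∀ z, z ∉ box L → F z = 0)
    (hdom : ∀ x, g x ≤ ∫⁻ z, heat s x z * F z) :
    (∫⁻ x, g x ^ 2) ^ 2 ≤ rowBound s (L / 2 ^ K) ^ 2 * (levelSq g L K * levelSq F L K) := by
  have h1 : ∫⁻ x, g x ^ 2 ≤ ∫⁻ x, g x * ∫⁻ z, heat s x z * F z :=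
    lintegral_mono fun x => by rw [sq]; exact mul_le_mul' le_rfl (hdom x)
  calc (∫⁻ x, g x ^ 2) ^ 2 ≤ (∫⁻ x, g x * ∫⁻ z, heat s x z * F z) ^ 2 := pow_le_pow_left' h1 2
    _ ≤ (∑ i, ∑ i', kerBound s (L / 2 ^ K) i i' * (blockMass g L K i * blockMass F L K i')) ^ 2 :=
        pow_le_pow_left' (lintegral_mul_heat_le_sum hL K hs hg hF hg0 hF0) 2
    _ ≤ rowBound s (L / 2 ^ K) ^ 2 * (levelSq g L K * levelSq F L K) :=
        schur_sq_le _ _ _ _ (sum_kerBound_le s _) (sum_kerBound_le' s _)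

/-- `[0, ∞]` arithmetic: `m² ≤ X·S ⟹ (m/S)² ≤ X/S` (junk cases `S ∈ {0, ∞}` included). -/
theorem sq_div_le_of_sq_le {m S X : ℝ≥0∞} (h : m ^ 2 ≤ X * S) : (m / S) ^ 2 ≤ X / S := by
  rcases eq_or_ne S 0 with rfl | hS0
  · have hm : m = 0 := by simpa using h
    simp [hm]
  rcases eq_or_ne S ⊤ with rfl | hSt
  · simp [ENNReal.div_top]
  calc (m / S) ^ 2 = m ^ 2 / S ^ 2 := by
        rw [div_eq_mul_inv, mul_pow, ← ENNReal.inv_pow, ← div_eq_mul_inv]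
    _ ≤ X * S / S ^ 2 := ENNReal.div_le_div_right h _
    _ = X / S := by rw [sq, ENNReal.mul_div_mul_right _ _ hS0 hSt]

/-- **(B) for the UV participation**: under `g ≤ P_s F`,
`r̄_K(g)² ≤ ℓ⁶ R(s,ℓ)² · S_K(F) / S_K(g)`. -/
theorem uvParticipation_sq_le {L : ℝ} (hL : 0 < L) (K : ℕ) {s : ℝ≥0} (hs : s ≠ 0)
    {g F : Space → ℝ≥0∞} (hg : Measurable g) (hF : Measurable F)
    (hg0 : ∀ x, x ∉ box L → g x = 0) (hF0 : ∀ z, z ∉ box L → F z = 0)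
    (hdom : ∀ x, g x ≤ ∫⁻ z, heat s x z * F z) :
    uvParticipation g L K ^ 2 ≤
      ENNReal.ofReal ((L / 2 ^ K) ^ 3) ^ 2 * rowBound s (L / 2 ^ K) ^ 2 *
        (levelSq F L K / levelSq g L K) := by
  unfold uvParticipation
  have h := sq_lintegral_sq_le hL K hs hg hF hg0 hF0 hdom
  have h' : (ENNReal.ofReal ((L / 2 ^ K) ^ 3) * ∫⁻ x, g x ^ 2) ^ 2 ≤
      (ENNReal.ofReal ((L / 2 ^ K) ^ 3) ^ 2 * rowBound s (L / 2 ^ K) ^ 2 * levelSq F L K) *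
        levelSq g L K := by
    rw [mul_pow]
    calc ENNReal.ofReal ((L / 2 ^ K) ^ 3) ^ 2 * (∫⁻ x, g x ^ 2) ^ 2
        ≤ ENNReal.ofReal ((L / 2 ^ K) ^ 3) ^ 2 *
            (rowBound s (L / 2 ^ K) ^ 2 * (levelSq g L K * levelSq F L K)) := mul_le_mul' le_rfl h
      _ = _ := by ring
  calc (ENNReal.ofReal ((L / 2 ^ K) ^ 3) * (∫⁻ x, g x ^ 2) / levelSq g L K) ^ 2
      ≤ (ENNReal.ofReal ((L / 2 ^ K) ^ 3) ^ 2 * rowBound s (L / 2 ^ K) ^ 2 * levelSq F L K) /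
          levelSq g L K := sq_div_le_of_sq_le h'
    _ = _ := mul_div_assoc _ _ _

/-! #### The two forms of the block masses of the majorant: `S_K(F) ≍ S_K(P_s F)` -/

/-- Volume of a dyadic block: `|Q| = ℓ³`, `ℓ = L2^{-j}` (`L ≥ 0`). -/
theorem volume_dyadicCube {L : ℝ} (hL : 0 ≤ L) (j : ℕ) (i : Fin 3 → Fin (2 ^ j)) :
    volume (dyadicCube L j i) = ENNReal.ofReal ((L / 2 ^ j) ^ 3) := by
  have h : dyadicCube L j i = (@WithLp.ofLp 2 (Fin 3 → ℝ)) ⁻¹'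
      (Set.univ.pi fun d => Set.Ico (L * (i d : ℕ) / 2 ^ j) (L * ((i d : ℕ) + 1) / 2 ^ j)) := by
    ext x; simp [dyadicCube]
  rw [h, (PiLp.volume_preserving_ofLp (Fin 3)).measure_preimage
    (MeasurableSet.univ_pi fun _ => measurableSet_Ico).nullMeasurableSet, volume_pi_pi]
  simp only [Real.volume_Ico]
  have h2 : ∀ d : Fin 3, L * ((i d : ℕ) + 1) / 2 ^ j - L * (i d : ℕ) / 2 ^ j = L / 2 ^ j :=
    fun d => by ring
  simp_rw [h2]
  rw [Finset.prod_const, Finset.card_univ, Fintype.card_fin, ENNReal.ofReal_pow (by positivity)]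

/-- **The smoothed function on a block**: for `x ∈ Q_i`,
`(P_sF)(x) ≤ Σ_{i'} kerBound(i, i') ∫_{Q_{i'}} F` (`F` vanishing off `Λ_L`). -/
theorem smooth_le_sum_on_block {L : ℝ} (hL : 0 < L) (K : ℕ) {s : ℝ≥0} (hs : s ≠ 0)
    {F : Space → ℝ≥0∞} (hF : Measurable F) (hF0 : ∀ z, z ∉ box L → F z = 0)
    {i : Fin 3 → Fin (2 ^ K)} {x : Space} (hx : x ∈ dyadicCube L K i) :
    ∫⁻ z, heat s x z * F z ≤ ∑ i', kerBound s (L / 2 ^ K) i i' * blockMass F L K i' := by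
  have h1 : ∫⁻ z, heat s x z * F z ≤ ∑ i', blockMass (fun z => heat s x z * F z) L K i' :=
    lintegral_le_sum_blockMass hL (fun z hz => by simp [hF0 z hz]) K
  refine h1.trans (Finset.sum_le_sum fun i' _ => ?_)
  unfold blockMass
  calc ∫⁻ z in dyadicCube L K i', heat s x z * F z
      ≤ ∫⁻ z in dyadicCube L K i', kerBound s (L / 2 ^ K) i i' * F z :=
        setLIntegral_mono' (measurableSet_dyadicCube L K i') fun z hz =>
          mul_le_mul' (heat_le_kerBound K hs hx hz) le_rfl
    _ = kerBound s (L / 2 ^ K) i i' * ∫⁻ z in dyadicCube L K i', F z :=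
        lintegral_const_mul _ hF

/-- **Discrete Schur test (operator form).** `Σ_i (Σ_{i'} K(i,i') b_{i'})² ≤ M² Σ b²`. -/
theorem schur_op_sq_le {ι : Type*} [Fintype ι] (Kf : ι → ι → ℝ≥0∞) (b : ι → ℝ≥0∞) (M : ℝ≥0∞)
    (hrow : ∀ i, ∑ i', Kf i i' ≤ M) (hcol : ∀ i', ∑ i, Kf i i' ≤ M) :
    ∑ i, (∑ i', Kf i i' * b i') ^ 2 ≤ M ^ 2 * ∑ i', b i' ^ 2 := by
  classical
  have hrowCS : ∀ i, (∑ i', Kf i i' * b i') ^ 2 ≤ M * ∑ i', Kf i i' * b i' ^ 2 := by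
    intro i
    have hCS := ENNReal.inner_le_Lp_mul_Lq Finset.univ (fun i' => Kf i i' ^ (1 / 2 : ℝ))
      (fun i' => Kf i i' ^ (1 / 2 : ℝ) * b i') Real.HolderConjugate.two_two
    have e1 : ∑ i', Kf i i' ^ (1 / 2 : ℝ) * (Kf i i' ^ (1 / 2 : ℝ) * b i') = ∑ i', Kf i i' * b i' :=
      Finset.sum_congr rfl fun i' _ => by
        calc Kf i i' ^ (1 / 2 : ℝ) * (Kf i i' ^ (1 / 2 : ℝ) * b i')
            = (Kf i i' ^ (1 / 2 : ℝ)) ^ 2 * b i' := by ring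
          _ = _ := by rw [rpow_half_sq]
    have e2 : ∑ i', (Kf i i' ^ (1 / 2 : ℝ)) ^ (2 : ℝ) = ∑ i', Kf i i' :=
      Finset.sum_congr rfl fun i' _ => by rw [ENNReal.rpow_two, rpow_half_sq]
    have e3 : ∑ i', (Kf i i' ^ (1 / 2 : ℝ) * b i') ^ (2 : ℝ) = ∑ i', Kf i i' * b i' ^ 2 :=
      Finset.sum_congr rfl fun i' _ => by rw [ENNReal.rpow_two, mul_pow, rpow_half_sq]
    rw [e1, e2, e3] at hCS
    calc (∑ i', Kf i i' * b i') ^ 2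
        ≤ ((∑ i', Kf i i') ^ (1 / (2 : ℝ)) * (∑ i', Kf i i' * b i' ^ 2) ^ (1 / (2 : ℝ))) ^ 2 :=
          pow_le_pow_left' hCS 2
      _ = (∑ i', Kf i i') * ∑ i', Kf i i' * b i' ^ 2 := by rw [mul_pow, rpow_half_sq, rpow_half_sq]
      _ ≤ M * ∑ i', Kf i i' * b i' ^ 2 := mul_le_mul' (hrow i) le_rfl
  calc ∑ i, (∑ i', Kf i i' * b i') ^ 2 ≤ ∑ i, M * ∑ i', Kf i i' * b i' ^ 2 :=
        Finset.sum_le_sum fun i _ => hrowCS i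
    _ = M * ∑ i', b i' ^ 2 * ∑ i, Kf i i' := by
        rw [← Finset.mul_sum, Finset.sum_comm]
        congr 1
        refine Finset.sum_congr rfl fun i' _ => ?_
        rw [Finset.mul_sum]
        refine Finset.sum_congr rfl fun i _ => ?_
        ring
    _ ≤ M * ∑ i', b i' ^ 2 * M :=
        mul_le_mul' le_rfl (Finset.sum_le_sum fun i' _ => mul_le_mul' le_rfl (hcol i'))
    _ = M ^ 2 * ∑ i', b i' ^ 2 := by rw [← Finset.sum_mul]; ring

/-- **Block masses of the smoothed function**: `S_K(P_s F) ≤ ℓ⁶ R(s,ℓ)² S_K(F)` for `F ≥ 0`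
measurable vanishing off `Λ_L`. -/
theorem levelSq_smooth_le {L : ℝ} (hL : 0 < L) (K : ℕ) {s : ℝ≥0} (hs : s ≠ 0)
    {F : Space → ℝ≥0∞} (hF : Measurable F) (hF0 : ∀ z, z ∉ box L → F z = 0) :
    levelSq (fun x => ∫⁻ z, heat s x z * F z) L K ≤
      ENNReal.ofReal ((L / 2 ^ K) ^ 3) ^ 2 * rowBound s (L / 2 ^ K) ^ 2 * levelSq F L K := by
  have hblock : ∀ i, blockMass (fun x => ∫⁻ z, heat s x z * F z) L K i ≤
      ENNReal.ofReal ((L / 2 ^ K) ^ 3) * ∑ i', kerBound s (L / 2 ^ K) i i' * blockMass F L K i' := by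
    intro i
    calc blockMass (fun x => ∫⁻ z, heat s x z * F z) L K i
        ≤ ∫⁻ _x in dyadicCube L K i, ∑ i', kerBound s (L / 2 ^ K) i i' * blockMass F L K i' :=
          setLIntegral_mono' (measurableSet_dyadicCube L K i) fun x hx =>
            smooth_le_sum_on_block hL K hs hF hF0 hx
      _ = (∑ i', kerBound s (L / 2 ^ K) i i' * blockMass F L K i') * volume (dyadicCube L K i) :=
          setLIntegral_const _ _
      _ = _ := by rw [volume_dyadicCube hL.le, mul_comm]
  calc levelSq (fun x => ∫⁻ z, heat s x z * F z) L K
      ≤ ∑ i, (ENNReal.ofReal ((L / 2 ^ K) ^ 3) *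
          ∑ i', kerBound s (L / 2 ^ K) i i' * blockMass F L K i') ^ 2 :=
        Finset.sum_le_sum fun i _ => pow_le_pow_left' (hblock i) 2
    _ = ENNReal.ofReal ((L / 2 ^ K) ^ 3) ^ 2 *
          ∑ i, (∑ i', kerBound s (L / 2 ^ K) i i' * blockMass F L K i') ^ 2 := by
        rw [Finset.mul_sum]
        refine Finset.sum_congr rfl fun i _ => ?_
        rw [mul_pow]
    _ ≤ ENNReal.ofReal ((L / 2 ^ K) ^ 3) ^ 2 * (rowBound s (L / 2 ^ K) ^ 2 * levelSq F L K) :=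
        mul_le_mul' le_rfl (schur_op_sq_le _ _ _ (sum_kerBound_le s _) (sum_kerBound_le' s _))
    _ = _ := by ring

/-- The floor of the heat kernel within one block: `κ(s, ℓ) = ((4πs)^{-1/2} e^{-ℓ²/(4s)})³`. -/
def kerFloor (s : ℝ≥0) (ℓ : ℝ) : ℝ :=
  ((Real.sqrt (2 * Real.pi * (2 * s)))⁻¹ * Real.exp (-(ℓ ^ 2 / (4 * s)))) ^ 3

theorem kerFloor_pos {s : ℝ≥0} (hs : s ≠ 0) (ℓ : ℝ) : 0 < kerFloor s ℓ := by
  unfold kerFloor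
  have : (0 : ℝ) < s := by exact_mod_cast pos_iff_ne_zero.2 hs
  positivity

/-- **Within a block the heat kernel is bounded below by `κ(s, ℓ)`.** -/
theorem kerFloor_le_heat {L : ℝ} (K : ℕ) {s : ℝ≥0} (hs : s ≠ 0) {i : Fin 3 → Fin (2 ^ K)}
    {x z : Space} (hx : x ∈ dyadicCube L K i) (hz : z ∈ dyadicCube L K i) :
    ENNReal.ofReal (kerFloor s (L / 2 ^ K)) ≤ heat s x z := by
  have hs' : (0 : ℝ) < s := by exact_mod_cast pos_iff_ne_zero.2 hs
  unfold kerFloor heat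
  have h3 : ENNReal.ofReal (((Real.sqrt (2 * Real.pi * (2 * s)))⁻¹ *
      Real.exp (-((L / 2 ^ K) ^ 2 / (4 * s)))) ^ 3) =
      ∏ _d : Fin 3, ENNReal.ofReal ((Real.sqrt (2 * Real.pi * (2 * s)))⁻¹ *
        Real.exp (-((L / 2 ^ K) ^ 2 / (4 * s)))) := by
    rw [Finset.prod_const, Finset.card_univ, Fintype.card_fin, ENNReal.ofReal_pow (by positivity)]
  rw [h3]
  refine Finset.prod_le_prod' fun d _ => ?_
  rw [gaussianPDF, gaussianPDFReal]
  refine ENNReal.ofReal_le_ofReal ?_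
  push_cast
  refine mul_le_mul_of_nonneg_left (Real.exp_le_exp.2 ?_) (inv_nonneg.2 (Real.sqrt_nonneg _))
  rw [show (2 : ℝ) * (2 * s) = 4 * s by ring, neg_div]
  refine neg_le_neg (div_le_div_of_nonneg_right ?_ (by positivity))
  have hxd := mem_Ico_of_mem_dyadicCube hx d
  have hzd := mem_Ico_of_mem_dyadicCube hz d
  rw [Set.mem_Ico] at hxd hzd
  have hℓ : 0 < L / 2 ^ K := by nlinarith [hxd.1, hxd.2]
  have h1 : |z d - x d| ≤ L / 2 ^ K := by
    rw [abs_le]; constructor <;> nlinarith [hxd.1, hxd.2, hzd.1, hzd.2]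
  calc (z d - x d) ^ 2 = |z d - x d| ^ 2 := (sq_abs _).symm
    _ ≤ (L / 2 ^ K) ^ 2 := pow_le_pow_left₀ (abs_nonneg _) h1 2

/-- **Block masses of `F` are controlled by those of `P_sF`**: `(κ ℓ³)² S_K(F) ≤ S_K(P_sF)`. -/
theorem levelSq_le_levelSq_smooth {L : ℝ} (hL : 0 < L) (K : ℕ) {s : ℝ≥0} (hs : s ≠ 0)
    {F : Space → ℝ≥0∞} (hF : Measurable F) :
    ENNReal.ofReal (kerFloor s (L / 2 ^ K) * (L / 2 ^ K) ^ 3) ^ 2 * levelSq F L K ≤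
      levelSq (fun x => ∫⁻ z, heat s x z * F z) L K := by
  unfold levelSq
  rw [Finset.mul_sum]
  refine Finset.sum_le_sum fun i _ => ?_
  rw [← mul_pow]
  refine pow_le_pow_left' ?_ 2
  have hκ : 0 ≤ kerFloor s (L / 2 ^ K) := (kerFloor_pos hs _).le
  calc ENNReal.ofReal (kerFloor s (L / 2 ^ K) * (L / 2 ^ K) ^ 3) * blockMass F L K i
      = (ENNReal.ofReal (kerFloor s (L / 2 ^ K)) * blockMass F L K i) *
          volume (dyadicCube L K i) := by
        rw [ENNReal.ofReal_mul hκ, volume_dyadicCube hL.le]; ring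
    _ = ∫⁻ _x in dyadicCube L K i, ENNReal.ofReal (kerFloor s (L / 2 ^ K)) * blockMass F L K i :=
        (setLIntegral_const _ _).symm
    _ ≤ ∫⁻ x in dyadicCube L K i, ∫⁻ z, heat s x z * F z :=
        setLIntegral_mono' (measurableSet_dyadicCube L K i) fun x hx => by
          calc ENNReal.ofReal (kerFloor s (L / 2 ^ K)) * blockMass F L K i
              = ∫⁻ z in dyadicCube L K i, ENNReal.ofReal (kerFloor s (L / 2 ^ K)) * F z :=
                (lintegral_const_mul _ hF).symm
            _ ≤ ∫⁻ z in dyadicCube L K i, heat s x z * F z :=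
                setLIntegral_mono' (measurableSet_dyadicCube L K i) fun z hz =>
                  mul_le_mul' (kerFloor_le_heat K hs hx hz) le_rfl
            _ ≤ ∫⁻ z, heat s x z * F z := setLIntegral_le_lintegral _ _

/-! #### Uniformity of the constants at the unit scale `ℓ ∈ (1/2, 1]` -/

/-- The row bound is monotone in the block side through its two ingredients: for
`0 ≤ ℓ₁ ≤ ℓ ≤ ℓ₂`, `R(s, ℓ) ≤ (A(s,ℓ₂) · 2/(1 - q(s,ℓ₁)))³`. -/
theorem rowBound_le {s : ℝ≥0} {ℓ ℓ₁ ℓ₂ : ℝ} (hℓ₁ : 0 ≤ ℓ₁) (h1 : ℓ₁ ≤ ℓ) (h2 : ℓ ≤ ℓ₂) :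
    rowBound s ℓ ≤
      (ENNReal.ofReal (kerConst s ℓ₂) * (2 * (1 - ENNReal.ofReal (kerRatio s ℓ₁))⁻¹)) ^ 3 := by
  unfold rowBound
  have hℓ : 0 ≤ ℓ := hℓ₁.trans h1
  have hs4 : (0 : ℝ) ≤ 4 * s := by positivity
  have hA : kerConst s ℓ ≤ kerConst s ℓ₂ := by
    unfold kerConst
    refine mul_le_mul_of_nonneg_left (Real.exp_le_exp.2 ?_) (inv_nonneg.2 (Real.sqrt_nonneg _))
    exact div_le_div_of_nonneg_right (pow_le_pow_left₀ hℓ h2 2) hs4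
  have hq : kerRatio s ℓ ≤ kerRatio s ℓ₁ := by
    unfold kerRatio
    refine Real.exp_le_exp.2 (neg_le_neg ?_)
    exact div_le_div_of_nonneg_right (pow_le_pow_left₀ hℓ₁ h1 2) hs4
  refine pow_le_pow_left' (mul_le_mul' (ENNReal.ofReal_le_ofReal hA) (mul_le_mul' le_rfl ?_)) 3
  exact ENNReal.inv_le_inv.2 (tsub_le_tsub_left (ENNReal.ofReal_le_ofReal hq) 1)

/-- The unit-scale row bound `R₁(s) = (A(s,1) · 2/(1 - q(s,1/2)))³`, valid for all `ℓ ∈ [1/2, 1]`. -/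
def rowBound₁ (s : ℝ≥0) : ℝ≥0∞ :=
  (ENNReal.ofReal (kerConst s 1) * (2 * (1 - ENNReal.ofReal (kerRatio s (1 / 2)))⁻¹)) ^ 3

theorem rowBound_le_rowBound₁ {s : ℝ≥0} {ℓ : ℝ} (h1 : 1 / 2 ≤ ℓ) (h2 : ℓ ≤ 1) :
    rowBound s ℓ ≤ rowBound₁ s :=
  rowBound_le (by norm_num) h1 h2

theorem rowBound₁_ne_top {s : ℝ≥0} (hs : s ≠ 0) : rowBound₁ s ≠ ⊤ := by
  unfold rowBound₁
  refine ENNReal.pow_ne_top (ENNReal.mul_ne_top ENNReal.ofReal_ne_top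
    (ENNReal.mul_ne_top (by norm_num) (ENNReal.inv_ne_top.2 ?_)))
  have hq : ENNReal.ofReal (kerRatio s (1 / 2)) < 1 :=
    ENNReal.ofReal_lt_one.2 (kerRatio_lt_one hs (by norm_num))
  exact (tsub_pos_of_lt hq).ne'

/-! #### The unit UV scale of the line: `ℓ = L·2^{-depth L} ∈ (1/2, 1]` for `L ≥ 1` -/

theorem div_pow_depth_le_one (L : ℝ) : L / 2 ^ depth L ≤ 1 := by
  have h2 : (0 : ℝ) < 2 ^ depth L := by positivity
  rw [div_le_one h2]
  have h1 : (⌈L⌉₊ : ℝ) ≤ (2 : ℝ) ^ depth L := by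
    have := Nat.le_pow_clog one_lt_two ⌈L⌉₊
    unfold depth
    exact_mod_cast this
  exact (Nat.le_ceil L).trans h1

theorem half_lt_div_pow_depth {L : ℝ} (hL : 1 ≤ L) : 1 / 2 < L / 2 ^ depth L := by
  have hL0 : 0 ≤ L := zero_le_one.trans hL
  have h2 : (0 : ℝ) < 2 ^ depth L := by positivity
  rw [lt_div_iff₀ h2]
  unfold depth
  by_cases h1 : ⌈L⌉₊ ≤ 1
  · rw [Nat.clog_of_right_le_one h1]
    norm_num
    linarith
  · have h1' : 1 < ⌈L⌉₊ := not_le.1 h1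
    have hK : 0 < Nat.clog 2 ⌈L⌉₊ := Nat.clog_pos one_lt_two h1'
    have hlt : 2 ^ (Nat.clog 2 ⌈L⌉₊).pred < ⌈L⌉₊ := Nat.pow_pred_clog_lt_self one_lt_two h1'
    have hceil : (⌈L⌉₊ : ℝ) < L + 1 := Nat.ceil_lt_add_one hL0
    have hlt' : (2 : ℝ) ^ (Nat.clog 2 ⌈L⌉₊).pred + 1 ≤ ⌈L⌉₊ := by
      have : 2 ^ (Nat.clog 2 ⌈L⌉₊).pred + 1 ≤ ⌈L⌉₊ := hlt
      exact_mod_cast this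
    have hpow : (2 : ℝ) ^ Nat.clog 2 ⌈L⌉₊ = 2 * 2 ^ (Nat.clog 2 ⌈L⌉₊).pred := by
      conv_lhs => rw [← Nat.succ_pred_eq_of_pos hK, pow_succ]
      ring
    rw [hpow]
    linarith

/-- The box of the route is eventually of side `≥ 1`, and always of positive side. -/
theorem sideLength_succ_pos' {ρ : ℝ} (hρ : 0 < ρ) (n : ℕ) : 0 < sideLength ρ (n + 1) := by
  unfold sideLength
  exact Real.rpow_pos_of_pos (by positivity) _

theorem one_le_sideLength {ρ : ℝ} (hρ : 0 < ρ) {n : ℕ} (hn : ⌈ρ⌉₊ ≤ n) : 1 ≤ sideLength ρ (n + 1) := by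
  unfold sideLength
  refine Real.one_le_rpow ?_ (by norm_num)
  rw [le_div_iff₀ hρ, one_mul]
  have h1 : ρ ≤ (⌈ρ⌉₊ : ℝ) := Nat.le_ceil ρ
  have h2 : (⌈ρ⌉₊ : ℝ) ≤ n := by exact_mod_cast hn
  push_cast
  linarith

/-! #### The witness slice is a constant multiple of the partition-function slice -/

/-- Degenerate normalisation makes the witness vanish identically. -/
theorem witness_eq_zero_of_normSq {v : ℝ → ℝ≥0∞} {L T : ℝ} {g : Config (n + 1) → ℝ≥0∞}
    (h : fkNormSq (N := n + 1) v L T g = 0 ∨ fkNormSq (N := n + 1) v L T g = ⊤)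
    (X : Config (n + 1)) : fkWitness (N := n + 1) v L T g X = 0 := by
  have h0 : (fkNormSq (N := n + 1) v L T g).toReal = 0 := by
    rcases h with h | h
    · rw [h, ENNReal.toReal_zero]
    · rw [h, ENNReal.toReal_top]
  rw [fkWitness_apply, h0, Real.sqrt_zero, div_zero]

/-- `‖Ψ_T(X)‖₊ = ofReal Ψ_T(X)` for the nonnegative witness. -/
theorem coe_nnnorm_witness (v : ℝ → ℝ≥0∞) (L T : ℝ) (g : Config (n + 1) → ℝ≥0∞)
    (X : Config (n + 1)) :
    ((‖fkWitness (N := n + 1) v L T g X‖₊ : ℝ≥0∞)) =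
      ENNReal.ofReal (fkWitness (N := n + 1) v L T g X) := by
  rw [← enorm_eq_nnnorm, Real.enorm_of_nonneg (fkWitness_nonneg v L T g X)]

/-- The witness slice is `(1/√‖Z_T‖₂²) · Z_T(x :: Y)` in `[0, ∞]`. -/
theorem slice_witness_eq_const_mul (v : ℝ → ℝ≥0∞) (L T : ℝ) (Y : Config n) (x : Space) :
    slice (fkWitness (N := n + 1) v L T (fun _ => (1 : ℝ≥0∞))) Y x =
      ENNReal.ofReal (1 / Real.sqrt (fkNormSq (N := n + 1) v L T (fun _ => (1 : ℝ≥0∞))).toReal) *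
        fkPartition v L T (Matrix.vecCons x Y) := by
  have hfin : fkPartition v L T (Matrix.vecCons x Y) ≠ ⊤ :=
    ne_top_of_le_ne_top ENNReal.one_ne_top (fkPartition_le_one v L T _)
  unfold slice
  rw [coe_nnnorm_witness, fkWitness_apply, div_eq_mul_one_div,
    ENNReal.ofReal_mul ENNReal.toReal_nonneg]
  unfold fkPartition at hfin ⊢
  rw [ENNReal.ofReal_toReal hfin, mul_comm]

/-- Block masses scale. -/
theorem blockMass_smul {c : ℝ≥0∞} (hc : c ≠ ⊤) (g : Space → ℝ≥0∞) (L : ℝ) (j : ℕ)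
    (i : Fin 3 → Fin (2 ^ j)) :
    blockMass (fun x => c * g x) L j i = c * blockMass g L j i := by
  unfold blockMass
  exact lintegral_const_mul' c _ hc

/-- Squared block sums scale quadratically. -/
theorem levelSq_smul {c : ℝ≥0∞} (hc : c ≠ ⊤) (g : Space → ℝ≥0∞) (L : ℝ) (j : ℕ) :
    levelSq (fun x => c * g x) L j = c ^ 2 * levelSq g L j := by
  unfold levelSq
  rw [Finset.mul_sum]
  refine Finset.sum_congr rfl fun i _ => ?_
  rw [blockMass_smul hc, mul_pow]

/-- **`r̄_K` is scale-free**: `uvParticipation (c·g) = uvParticipation g` for `c ∈ (0, ∞)`. -/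
theorem uvParticipation_smul {c : ℝ≥0∞} (hc0 : c ≠ 0) (hc : c ≠ ⊤) (g : Space → ℝ≥0∞)
    (L : ℝ) (K : ℕ) :
    uvParticipation (fun x => c * g x) L K = uvParticipation g L K := by
  unfold uvParticipation
  have h2 : ∫⁻ x, (c * g x) ^ 2 = c ^ 2 * ∫⁻ x, g x ^ 2 := by
    simp_rw [mul_pow]
    exact lintegral_const_mul' _ _ (ENNReal.pow_ne_top hc)
  rw [h2, levelSq_smul hc, mul_left_comm,
    ENNReal.mul_div_mul_left _ _ (pow_ne_zero 2 hc0) (ENNReal.pow_ne_top hc)]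

end UVFlatnessR3

/-! ### The missing comparison (step (iii) of route R3) and the reduction to it -/

/-- **THE MISSING INPUT of route R3 (step (iii)): block-mass comparison for the one-step
majorant, in slice-law mean.** For admissible `v`, `ρ < ρ₀(v)`, SOME smoothing time `s ∈ (0, 1]`
and constant `C`, eventually in `n`, uniformly in `T ≥ 1` — with `L = sideLength ρ (n+1)`,
`K = depth L` (unit blocks `Q` of side `ℓ = L2^{-K} ∈ (1/2, 1]`), `Z_t = fkPartition v L t`
(`= e^{-tH_{n+1}}1`), the slice `g_Y(x) = Z_T(x :: Y)`, its mass `m(Y) = ∫ g_Y²`, and the one-step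
bath majorant `F_Y(z) = ∫ fkWeight v L s Y ωb · Z_{T-s}(z :: B_s(ωb)) dW_n(ωb)` (inlined below;
`= UVFlatnessR3.stepMajorant v L s (T-s) Y z`: the bath evolved for time `s` under its own killed
interacting weight, the tagged particle re-inserted at `z` at time `s`):
  `∫ m(Y) · [Σ_Q (∫_Q F_Y)² / Σ_Q (∫_Q g_Y)²] dY ≤ C · ‖Z_T‖₂²`,
i.e. `E_m[S_K(F_Y)/S_K(g_Y)] ≤ C` under the slice law `m(Y)dY/‖Z_T‖₂²`. Since `g_Y ≤ P_s F_Y`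
((A)) and `S_K(P_sF) ≍ S_K(F)` (`levelSq_smooth_le`, `levelSq_le_levelSq_smooth`), and
`(P_sF_Y)(x) = E_{x::Y}[w^bath_s · Z_{T-s}(X_s)]` is `Z_T(x::Y)` with the tagged factor removed on
`[0, s]`, this says: re-inserting the TAGGED weight on `[0, s]` (Dirichlet survival of the tagged line and `e^{-∫₀ˢ Σ_j v(|B⁰-Bʲ|)}`) costs at
most a constant factor in the `ℓ²`-norm of the unit-block masses, on `m`-average — a lower bound
on the tagged weight integrated over the starting points of a block given the bath (free blocks),
plus "crowded blocks carry little `F`-mass" (hard cores: packing; soft `v`: `ρ₀(v)` small). With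
(A) `fkPartition_vecCons_le_gaussian_step` and (B) `uvParticipation_sq_le` it implies `UVFlatness`
(`uvFlatness_of_blockMassComparison`, constant `(R₁(s)² + 1)·C`). Absent from the tree: needs
no-crowding / superstability-type control of the tilted bath law `fkWeight dW_n` under `m(Y)dY`,
uniformly in `n` and `T`. -/
def BlockMassComparison : Prop :=
  ∀ v : ℝ → ℝ≥0∞, IsRepulsiveFiniteRange v → ∃ ρ₀ : ℝ, 0 < ρ₀ ∧ ∀ ρ : ℝ, 0 < ρ → ρ < ρ₀ →
    ∃ s : ℝ, 0 < s ∧ s ≤ 1 ∧ ∃ C : ℝ, 0 < C ∧ ∀ᶠ n : ℕ in atTop, ∀ T : ℝ, 1 ≤ T →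
      ∫⁻ Y : Config n,
          (∫⁻ x, fkPartition v (sideLength ρ (n + 1)) T (Matrix.vecCons x Y) ^ 2) *
            (levelSq (fun z => ∫⁻ ωb, fkWeight v (sideLength ρ (n + 1)) s Y ωb *
                fkPartition v (sideLength ρ (n + 1)) (T - s)
                  (Matrix.vecCons z (worldLine Y ωb s.toNNReal)) ∂wienerPaths n)
                (sideLength ρ (n + 1)) (depth (sideLength ρ (n + 1))) /
              levelSq (fun x => fkPartition v (sideLength ρ (n + 1)) T (Matrix.vecCons x Y))
                (sideLength ρ (n + 1)) (depth (sideLength ρ (n + 1)))) ≤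
        ENNReal.ofReal C *
          fkNormSq (N := n + 1) v (sideLength ρ (n + 1)) T (fun _ => (1 : ℝ≥0∞))

open UVFlatnessR3 in
/-- **Route R3: `BlockMassComparison → UVFlatness`** (kernel-checked reduction; constant
`C ↦ (R₁(s)² + 1)·C`). Slice by slice, `g_Y = Z_T(·::Y) ≤ P_s F_Y` by the one-step domination (A),
so `r̄_K(g_Y)² ≤ ℓ⁶ R(s,ℓ)² S_K(F_Y)/S_K(g_Y) ≤ R₁(s)² S_K(F_Y)/S_K(g_Y)` by the smoothing–block
inequality (B) at the unit scale `ℓ = L2^{-K} ∈ (1/2, 1]`; the witness slice is `Z_T(·::Y)/‖Z_T‖₂`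
(`r̄` is scale-free) and the slice law has mass `‖Z_T‖₂²/‖Z_T‖₂² = 1`. -/
theorem uvFlatness_of_blockMassComparison (h : BlockMassComparison) : UVFlatness := by
  intro v hv
  obtain ⟨ρ₀, hρ₀, H⟩ := h v hv
  refine ⟨ρ₀, hρ₀, fun ρ hρ hρlt => ?_⟩
  obtain ⟨s, hs0, hs1, C, hC, hev⟩ := H ρ hρ hρlt
  have hs' : s.toNNReal ≠ 0 := by simpa [Real.toNNReal_eq_zero] using hs0
  set R : ℝ≥0∞ := rowBound₁ s.toNNReal with hRdef
  have hRtop : R ≠ ⊤ := rowBound₁_ne_top hs'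
  have hR2top : R ^ 2 ≠ ⊤ := ENNReal.pow_ne_top hRtop
  refine ⟨((R ^ 2).toReal + 1) * C, by positivity, ?_⟩
  filter_upwards [hev, eventually_ge_atTop ⌈ρ⌉₊] with n hn hnρ T hT
  have hvm : Measurable v := hv.1
  set L : ℝ := sideLength ρ (n + 1) with hLdef
  set K : ℕ := depth L with hKdef
  have hL : 0 < L := sideLength_succ_pos' hρ n
  have hL1 : 1 ≤ L := one_le_sideLength hρ hnρ
  have hℓ1 : L / 2 ^ K ≤ 1 := div_pow_depth_le_one L
  have hℓ2 : 1 / 2 < L / 2 ^ K := half_lt_div_pow_depth hL1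
  set Ψ : Config (n + 1) → ℝ := fkWitness (N := n + 1) v L T (fun _ => (1 : ℝ≥0∞)) with hΨdef
  -- degenerate normalisation: the witness vanishes identically
  by_cases hdeg : fkNormSq (N := n + 1) v L T (fun _ => (1 : ℝ≥0∞)) = 0 ∨
      fkNormSq (N := n + 1) v L T (fun _ => (1 : ℝ≥0∞)) = ⊤
  · have hΨ0 : ∀ X, Ψ X = 0 := witness_eq_zero_of_normSq hdeg
    have hsl : ∀ Y : Config n, slice Ψ Y = fun _ => 0 :=
      fun Y => funext fun x => by simp [slice, hΨ0]
    simp [hsl]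
  simp only [not_or] at hdeg
  obtain ⟨h𝒩0, h𝒩t⟩ := hdeg
  set 𝒩 : ℝ≥0∞ := fkNormSq (N := n + 1) v L T (fun _ => (1 : ℝ≥0∞)) with h𝒩def
  set c : ℝ≥0∞ := ENNReal.ofReal (1 / Real.sqrt 𝒩.toReal) with hcdef
  have h𝒩pos : 0 < 𝒩.toReal := ENNReal.toReal_pos h𝒩0 h𝒩t
  have hc0 : c ≠ 0 := (ENNReal.ofReal_pos.2 (by positivity)).ne'
  have hctop : c ≠ ⊤ := ENNReal.ofReal_ne_top
  have hc𝒩 : c ^ 2 * 𝒩 = 1 := by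
    have hc2 : c ^ 2 = ENNReal.ofReal (𝒩.toReal)⁻¹ := by
      rw [hcdef, ← ENNReal.ofReal_pow (by positivity), one_div, inv_pow, Real.sq_sqrt h𝒩pos.le]
    rw [hc2, ENNReal.ofReal_inv_of_pos h𝒩pos, ENNReal.ofReal_toReal h𝒩t,
      ENNReal.inv_mul_cancel h𝒩0 h𝒩t]
  -- the partition-function slice and its one-step majorant
  set Z : Config n → Space → ℝ≥0∞ := fun Y x => fkPartition v L T (Matrix.vecCons x Y) with hZdef
  set F : Config n → Space → ℝ≥0∞ := fun Y => stepMajorant v L s (T - s) Y with hFdef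
  have hslice : ∀ Y, slice Ψ Y = fun x => c * Z Y x :=
    fun Y => funext (slice_witness_eq_const_mul v L T Y)
  -- slice by slice
  have hpt : ∀ Y, (∫⁻ x, slice Ψ Y x ^ 2) * uvParticipation (slice Ψ Y) L K ^ 2 ≤
      (c ^ 2 * R ^ 2) * ((∫⁻ x, Z Y x ^ 2) * (levelSq (F Y) L K / levelSq (Z Y) L K)) := by
    intro Y
    rw [hslice Y, uvParticipation_smul hc0 hctop]
    have hm : ∫⁻ x, (c * Z Y x) ^ 2 = c ^ 2 * ∫⁻ x, Z Y x ^ 2 := by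
      simp_rw [mul_pow]
      exact lintegral_const_mul' _ _ (ENNReal.pow_ne_top hctop)
    rw [hm]
    have hZm : Measurable (Z Y) := by
      have h1 : Measurable fun x : Space => Matrix.vecCons x Y :=
        measurable_vecCons.comp (measurable_id.prodMk measurable_const)
      have h2 := (measurable_fkSemigroup hvm L T (measurable_const (a := (1 : ℝ≥0∞)))).comp h1
      exact h2
    have hFm : Measurable (F Y) := measurable_stepMajorant hvm L s (T - s) Y
    have hZ0 : ∀ x, x ∉ box L → Z Y x = 0 := fun x hx =>
      fkSemigroup_of_notMem v (by linarith) _ fun hX => hx (by simpa using hX 0)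
    have hF0 : ∀ z, z ∉ box L → F Y z = 0 := fun z hz =>
      stepMajorant_of_notMem v L s (by linarith) Y hz
    have hdom : ∀ x, Z Y x ≤ ∫⁻ z, heat s.toNNReal x z * F Y z := by
      intro x
      have h1 := fkPartition_vecCons_le_gaussian_step hvm L hs0 (t := T - s) (by linarith) x Y
      rwa [add_sub_cancel] at h1
    have huv : uvParticipation (Z Y) L K ^ 2 ≤ R ^ 2 * (levelSq (F Y) L K / levelSq (Z Y) L K) := by
      calc uvParticipation (Z Y) L K ^ 2
          ≤ ENNReal.ofReal ((L / 2 ^ K) ^ 3) ^ 2 * rowBound s.toNNReal (L / 2 ^ K) ^ 2 *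
              (levelSq (F Y) L K / levelSq (Z Y) L K) :=
            uvParticipation_sq_le hL K hs' hZm hFm hZ0 hF0 hdom
        _ ≤ 1 ^ 2 * R ^ 2 * (levelSq (F Y) L K / levelSq (Z Y) L K) := by
            refine mul_le_mul' (mul_le_mul' (pow_le_pow_left' ?_ 2) (pow_le_pow_left' ?_ 2)) le_rfl
            · exact ENNReal.ofReal_le_one.2 (pow_le_one₀ (by linarith) hℓ1)
            · exact rowBound_le_rowBound₁ hℓ2.le hℓ1
        _ = _ := by rw [one_pow, one_mul]
    calc c ^ 2 * (∫⁻ x, Z Y x ^ 2) * uvParticipation (Z Y) L K ^ 2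
        ≤ c ^ 2 * (∫⁻ x, Z Y x ^ 2) * (R ^ 2 * (levelSq (F Y) L K / levelSq (Z Y) L K)) :=
          mul_le_mul' le_rfl huv
      _ = _ := by ring
  -- integrate over the slices
  calc ∫⁻ Y, (∫⁻ x, slice Ψ Y x ^ 2) * uvParticipation (slice Ψ Y) L K ^ 2
      ≤ ∫⁻ Y, (c ^ 2 * R ^ 2) * ((∫⁻ x, Z Y x ^ 2) * (levelSq (F Y) L K / levelSq (Z Y) L K)) :=
        lintegral_mono hpt
    _ = (c ^ 2 * R ^ 2) * ∫⁻ Y, (∫⁻ x, Z Y x ^ 2) * (levelSq (F Y) L K / levelSq (Z Y) L K) :=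
        lintegral_const_mul' _ _ (ENNReal.mul_ne_top (ENNReal.pow_ne_top hctop) hR2top)
    _ ≤ (c ^ 2 * R ^ 2) * (ENNReal.ofReal C * 𝒩) := mul_le_mul' le_rfl (hn T hT)
    _ = R ^ 2 * ENNReal.ofReal C * (c ^ 2 * 𝒩) := by ring
    _ = ENNReal.ofReal (R ^ 2).toReal * ENNReal.ofReal C := by
        rw [hc𝒩, mul_one, ENNReal.ofReal_toReal hR2top]
    _ ≤ ENNReal.ofReal ((R ^ 2).toReal + 1) * ENNReal.ofReal C :=
        mul_le_mul' (ENNReal.ofReal_le_ofReal (by linarith)) le_rfl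
    _ = ENNReal.ofReal (((R ^ 2).toReal + 1) * C) :=
        (ENNReal.ofReal_mul (by positivity)).symm





/-- The registered stub follows from the missing input (iii) (audit alias form). -/
theorem stub_uvFlatness_of_blockMassComparison (h : BlockMassComparison) : Goal.stub_uvFlatness :=
  uvFlatness_of_blockMassComparison h

end Summit.AtomisticToContinuum.BoseEinsteinCondensation.Cruxes.LandscapeBound.SiblingTelescopingChaining

end
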